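import Literature.Analysis.FluidPDE.PeriodicEnergyAxis
import Literature.Analysis.FluidPDE.PeriodicWeightedPoincare
import HarnessLib

/-!
# Lei–Ren–Zhang 2019, (3.7): the axis term of the logarithmic estimate per period

Analysis/FluidPDE proofs file (theorems only, no definitions, no named facts), on the discharge
path of the named fact `Literature.Analysis.FluidPDE.leiRenZhang2019_liouville_periodic`
(Z. Lei, X. Ren, Q. S. Zhang, arXiv:1902.11229 = Math. Ann. 383 (2022), Theorem 1.1). Proof of
Lemma 3.1, (3.7) (arXiv p. 7): "integration by parts and (3.6) give
`−∫(2/r)∂ᵣΨζ_R² dx = 2∬(Ψ − Ψ̄)ζ_R² dθdz|_{r=0} + 2∭(Ψ − Ψ̄)∂ᵣζ_R² dr dθ dz = C − CΨ̄ + 2∫(Ψ − Ψ̄)∂ᵣζ_R²/r dx`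
`≤ C − CΨ̄ + (1/6)∫|∇Ψ|²ζ_R² + CR²∫(∂ᵣζ_R/r)² dx`", per period, for the `z`-independent
cylindrical cut-off `ζ = cylCutoff (ρ/2) ρ` — the periodic twin of the tree's
`LeiZhang2011.integral_axis_term_log_le` (there for the spherical cut-off):

* `cylCutoff_sq_slab_mass` — `ρ²P/4 ≤ Z = ∫_{slab} ζ² ≤ 4ρ²P`, `|slab ∩ {r ≤ ρ}| ≤ 4ρ²P`
  ("`|D_R| ∼ R²`" per period);
* `abs_axis_weight_cylCutoff_sq_le` — `|(2/r)∂ᵣ(ζ²)| ≤ (8C_T/(ρ₁² − ρ₂²)) ζ`;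
* `setIntegral_axis_weight_cylCutoff_sq` — `∫_{slab} (2/r)∂ᵣ(ζ²) = −2c₂P` (the boundary term
  per period);
* `integral_axis_term_log_le_periodic` — for `0 < P ≤ ρ`, a periodic `Ψ ∈ C¹` and `δ > 0`,
  `∫_{slab}(2/r)Ψ∂ᵣ(ζ²) ≤ δ∫_{slab}‖∇Ψ‖²ζ² + (1048576 C_T²/(9δ)) P − (2c₂P/Z)∫_{slab}Ψζ²`.

## References

* Z. Lei, X. Ren, Q. S. Zhang, arXiv:1902.11229, §3, proof of Lemma 3.1, (3.7) (arXiv p. 7).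
  [LeiRenZhang2019]
* Z. Lei, Q. S. Zhang, arXiv:1011.5066, proof of Lemma 3.2 (p. 9), the axis term (tree
  `LeiZhang2011.integral_axis_term_log_le`). [LeiZhang2011]
-/

noncomputable section

open MeasureTheory Set Function Filter Metric intervalIntegral
open _root_.Topology
open scoped InnerProductSpace RealInnerProductSpace NNReal ENNReal

namespace Literature.Analysis.FluidPDE

namespace LeiRenZhang2019

open LeiZhang2011

/-! ### Slab geometry of the cylindrical cut-off -/

/-- The box `{|x₀| ≤ a, |x₁| ≤ a, 0 ≤ x₂ < P}` has volume `2a · 2a · P`. [folklore] -/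
private theorem volume_box_pla {a P : ℝ} (ha : 0 ≤ a) :
    volume {x : EuclideanSpace ℝ (Fin 3) | |x 0| ≤ a ∧ |x 1| ≤ a ∧ x 2 ∈ Ico 0 P} =
      ENNReal.ofReal (2 * a * (2 * a) * P) := by
  classical
  have hset : {x : EuclideanSpace ℝ (Fin 3) | |x 0| ≤ a ∧ |x 1| ≤ a ∧ x 2 ∈ Ico 0 P} =
      (WithLp.ofLp : EuclideanSpace ℝ (Fin 3) → (Fin 3 → ℝ)) ⁻¹'
        Set.univ.pi (fun i : Fin 3 => if i = 2 then Ico 0 P else Icc (-a) a) := by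
    ext x
    simp only [mem_setOf_eq, mem_preimage, mem_univ_pi]
    constructor
    · rintro ⟨h0, h1, h2⟩ i
      fin_cases i
      · simpa [abs_le] using h0
      · simpa [abs_le] using h1
      · simpa using h2
    · intro h
      have h0 := h 0
      have h1 := h 1
      have h2 := h 2
      simp only [Fin.isValue, Fin.reduceEq, ↓reduceIte, mem_Icc] at h0 h1 h2
      exact ⟨abs_le.2 h0, abs_le.2 h1, h2⟩
  have hmeas : MeasurableSet (Set.univ.pi (fun i : Fin 3 => if i = 2 then Ico (0 : ℝ) P else Icc (-a) a)) :=
    MeasurableSet.univ_pi fun i => by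
      by_cases hi : i = 2
      · simp only [hi, ↓reduceIte]; exact measurableSet_Ico
      · simp only [hi, ↓reduceIte]; exact measurableSet_Icc
  rw [hset, (PiLp.volume_preserving_ofLp (Fin 3)).measure_preimage hmeas.nullMeasurableSet,
    volume_pi, Measure.pi_pi, Fin.prod_univ_three]
  simp only [Fin.isValue, Fin.reduceEq, ↓reduceIte, Real.volume_Icc, Real.volume_Ico, sub_neg_eq_add,
    sub_zero]
  rw [← ENNReal.ofReal_mul (by linarith), ← ENNReal.ofReal_mul (by positivity)]
  congr 1; ring

/-- `|x₀|, |x₁| ≤ r`. [folklore] -/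
private theorem abs_apply_le_cylRadius_pla (x : EuclideanSpace ℝ (Fin 3)) :
    |x 0| ≤ cylRadius x ∧ |x 1| ≤ cylRadius x := by
  rw [cylRadius]
  exact ⟨Real.abs_le_sqrt (by nlinarith [sq_nonneg (x 1)]), Real.abs_le_sqrt (by nlinarith [sq_nonneg (x 0)])⟩

/-- **Slab mass of the cylindrical cut-off** ("`|D_R| ∼ R²`" per period): for `P, ρ > 0` and
`ζ = cylCutoff (ρ/2) ρ`, `ρ²P/4 ≤ ∫_{zSlab P 0} ζ² ≤ 4ρ²P` and `|zSlab P 0 ∩ {r ≤ ρ}| ≤ 4ρ²P`. [cite: LeiRenZhang2019, §3 (3.4)–(3.7) ("here we just used |D_R| ∼ R² for large R"), arXiv p. 7] -/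
theorem cylCutoff_sq_slab_mass {P ρ : ℝ} (hP : 0 < P) (hρ : 0 < ρ) :
    ρ ^ 2 * P / 4 ≤ ∫ y in zSlab P 0, cylCutoff (ρ / 2) ρ y ^ 2 ∧
    ∫ y in zSlab P 0, cylCutoff (ρ / 2) ρ y ^ 2 ≤ 4 * ρ ^ 2 * P ∧
    volume.real (zSlab P 0 ∩ {x : EuclideanSpace ℝ (Fin 3) | cylRadius x ≤ ρ}) ≤ 4 * ρ ^ 2 * P := by
  set φ : EuclideanSpace ℝ (Fin 3) → ℝ := cylCutoff (ρ / 2) ρ with hφdef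
  have hρ2 : 0 ≤ ρ / 2 := by positivity
  have hρρ : ρ / 2 < ρ := half_lt_self hρ
  have hφc : Continuous φ := (contDiff_cylCutoff (ρ / 2) ρ (n := 0)).continuous
  have hφ0 : ∀ x, 0 ≤ φ x := fun x => cylCutoff_nonneg _ _ _
  have hφ1 : ∀ x, φ x ≤ 1 := fun x => cylCutoff_le_one _ _ _
  have hφρ : ∀ x, ρ ≤ cylRadius x → φ x = 0 := fun x hx => cylCutoff_eq_zero hρ2 hρρ hx
  have hφone : ∀ x, cylRadius x ≤ ρ / 2 → φ x = 1 := fun x hx => cylCutoff_eq_one hρ2 hρρ hx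
  have hφ2i : IntegrableOn (fun x => φ x ^ 2) (zSlab P 0) volume :=
    integrableOn_zSlab_of_eq_zero_of_le_cylRadius (hφc.pow 2) (ρ := ρ) (fun x hx => by simp [hφρ x hx]) P 0
  -- the boxes
  set Bs : Set (EuclideanSpace ℝ (Fin 3)) := {x | |x 0| ≤ ρ / 4 ∧ |x 1| ≤ ρ / 4 ∧ x 2 ∈ Ico 0 P} with hBs
  set Bb : Set (EuclideanSpace ℝ (Fin 3)) := {x | |x 0| ≤ ρ ∧ |x 1| ≤ ρ ∧ x 2 ∈ Ico 0 P} with hBb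
  have hx2m : Measurable fun x : EuclideanSpace ℝ (Fin 3) => x 2 :=
    (EuclideanSpace.proj (𝕜 := ℝ) (2 : Fin 3)).continuous.measurable
  have hx0m : Measurable fun x : EuclideanSpace ℝ (Fin 3) => x 0 :=
    (EuclideanSpace.proj (𝕜 := ℝ) (0 : Fin 3)).continuous.measurable
  have hx1m : Measurable fun x : EuclideanSpace ℝ (Fin 3) => x 1 :=
    (EuclideanSpace.proj (𝕜 := ℝ) (1 : Fin 3)).continuous.measurable
  have hBmeas : ∀ a : ℝ, MeasurableSet {x : EuclideanSpace ℝ (Fin 3) | |x 0| ≤ a ∧ |x 1| ≤ a ∧ x 2 ∈ Ico 0 P} :=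
    fun a => (measurableSet_le hx0m.abs measurable_const).inter
      ((measurableSet_le hx1m.abs measurable_const).inter (measurableSet_Ico.preimage hx2m))
  have hVs : volume Bs = ENNReal.ofReal (2 * (ρ / 4) * (2 * (ρ / 4)) * P) := volume_box_pla (by positivity)
  have hVb : volume Bb = ENNReal.ofReal (2 * ρ * (2 * ρ) * P) := volume_box_pla hρ.le
  have hVb_top : volume Bb ≠ ∞ := by rw [hVb]; exact ENNReal.ofReal_ne_top
  have hVb_real : volume.real Bb = 4 * ρ ^ 2 * P := by
    rw [measureReal_def, hVb, ENNReal.toReal_ofReal (by positivity)]; ring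
  have hVs_real : volume.real Bs = ρ ^ 2 * P / 4 := by
    rw [measureReal_def, hVs, ENNReal.toReal_ofReal (by positivity)]; ring
  -- `slab ∩ {r ≤ ρ} ⊆ Bb`, `Bs ⊆ slab`, `r ≤ ρ/2` on `Bs`
  have hsub_b : zSlab P 0 ∩ {x : EuclideanSpace ℝ (Fin 3) | cylRadius x ≤ ρ} ⊆ Bb := by
    rintro x ⟨hx, hr⟩
    have h := abs_apply_le_cylRadius_pla x
    have hx' := mem_zSlab.1 hx
    simp only [Int.cast_zero, zero_mul, zero_add, one_mul] at hx'
    exact ⟨h.1.trans hr, h.2.trans hr, hx'⟩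
  have hsub_s : Bs ⊆ zSlab P 0 := by
    rintro x ⟨-, -, hx2⟩
    rw [mem_zSlab]; simpa using hx2
  have hBs_r : ∀ x ∈ Bs, cylRadius x ≤ ρ / 2 := by
    rintro x ⟨h0, h1, -⟩
    have hsq : cylRadius x ^ 2 ≤ (ρ / 2) ^ 2 := by
      rw [cylRadius_sq]; nlinarith [abs_nonneg (x 0), abs_nonneg (x 1), sq_abs (x 0), sq_abs (x 1)]
    exact (pow_le_pow_iff_left₀ (cylRadius_nonneg x) hρ2 two_ne_zero).1 hsq
  have hS_top : volume (zSlab P 0 ∩ {x : EuclideanSpace ℝ (Fin 3) | cylRadius x ≤ ρ}) ≠ ∞ :=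
    ((measure_mono hsub_b).trans_lt hVb_top.lt_top).ne
  have hS_meas : MeasurableSet (zSlab P 0 ∩ {x : EuclideanSpace ℝ (Fin 3) | cylRadius x ≤ ρ}) :=
    (measurableSet_zSlab P 0).inter (measurableSet_le continuous_cylRadius.measurable measurable_const)
  have hS_real : volume.real (zSlab P 0 ∩ {x : EuclideanSpace ℝ (Fin 3) | cylRadius x ≤ ρ}) ≤ 4 * ρ ^ 2 * P := by
    rw [← hVb_real]; exact measureReal_mono hsub_b hVb_top
  refine ⟨?_, ?_, hS_real⟩
  · -- lower bound
    calc ρ ^ 2 * P / 4 = volume.real Bs := hVs_real.symm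
      _ = ∫ x in Bs, φ x ^ 2 := by
          rw [setIntegral_congr_fun (hBmeas _) (g := fun _ => (1 : ℝ))
            (fun x hx => by simp only [hφone x (hBs_r x hx), one_pow]), setIntegral_const, smul_eq_mul, mul_one]
      _ ≤ ∫ x in zSlab P 0, φ x ^ 2 :=
          setIntegral_mono_set hφ2i (ae_of_all _ fun x => sq_nonneg _) (ae_of_all _ hsub_s)
  · -- upper bound
    calc ∫ x in zSlab P 0, φ x ^ 2 = ∫ x in zSlab P 0 ∩ {x | cylRadius x ≤ ρ}, φ x ^ 2 :=
          setIntegral_eq_of_subset_of_forall_sdiff_eq_zero (measurableSet_zSlab P 0) inter_subset_left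
            fun x hx => by
              have hr : ¬cylRadius x ≤ ρ := fun h => hx.2 ⟨hx.1, h⟩
              simp [hφρ x (not_le.1 hr).le]
      _ ≤ ∫ x in zSlab P 0 ∩ {x | cylRadius x ≤ ρ}, (1 : ℝ) := by
          refine setIntegral_mono_on (hφ2i.mono_set inter_subset_left) ?_ hS_meas fun x _ => ?_
          · exact integrableOn_const hS_top
          · exact pow_le_one₀ (hφ0 x) (hφ1 x)
      _ = volume.real (zSlab P 0 ∩ {x | cylRadius x ≤ ρ}) := by rw [setIntegral_const, smul_eq_mul, mul_one]
      _ ≤ 4 * ρ ^ 2 * P := hS_real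

/-- The closed period box `[0, L] × {r ≤ ρ}` is compact. [folklore] -/
private theorem isCompact_box_pla (L ρ : ℝ) :
    IsCompact {x : EuclideanSpace ℝ (Fin 3) | x 2 ∈ Icc 0 L ∧ cylRadius x ≤ ρ} := by
  have hx2 : Continuous fun x : EuclideanSpace ℝ (Fin 3) => x 2 :=
    (EuclideanSpace.proj (𝕜 := ℝ) (2 : Fin 3)).continuous
  refine Metric.isCompact_of_isClosed_isBounded ?_ ?_
  · exact (isClosed_Icc.preimage hx2).inter (isClosed_le continuous_cylRadius continuous_const)
  · refine (Metric.isBounded_closedBall (x := (0 : EuclideanSpace ℝ (Fin 3))) (r := ρ + |L|)).subset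
      fun x hx => ?_
    rw [mem_closedBall_zero_iff]
    have h := norm_le_cylRadius_add_abs_apply_two x
    have h2 : |x 2| ≤ |L| := by
      rw [abs_le]
      exact ⟨by linarith [hx.1.1, abs_nonneg L], hx.1.2.trans (le_abs_self L)⟩
    linarith [hx.2]

/-! ### The axis weight `(2/r)∂ᵣ(ζ²)` -/

/-- **The axis weight of the cylindrical cut-off is bounded by the cut-off**:
`|(2/r)∂ᵣ(ζ²)(x)| ≤ (8C_T/(ρ₁² − ρ₂²)) ζ(x)` for `ζ = cylCutoff ρ₂ ρ₁` (the spherical statement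
`LeiZhang2011.abs_axis_weight_radialCutoff_sq_le` at the horizontal point `x_h`). [cite: LeiRenZhang2019, §3 (3.7) (the weight ∂ᵣζ_R/r, "CR²∫(∂ᵣζ_R/r)²dx ≤ C"), arXiv p. 7] -/
theorem abs_axis_weight_cylCutoff_sq_le {ρ₂ ρ₁ : ℝ} (h₀ : 0 ≤ ρ₂) (h₁ : ρ₂ < ρ₁) {CT : ℝ}
    (hCT : ∀ t, |deriv Real.smoothTransition t| ≤ CT) (x : EuclideanSpace ℝ (Fin 3)) :
    |2 / cylRadius x * fderiv ℝ (fun y => cylCutoff ρ₂ ρ₁ y ^ 2) x (eR x)| ≤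
      8 * CT / (ρ₁ ^ 2 - ρ₂ ^ 2) * cylCutoff ρ₂ ρ₁ x := by
  have hrad := abs_axis_weight_radialCutoff_sq_le h₀ h₁ hCT (horizPart x)
  have hζd : DifferentiableAt ℝ (cylCutoff ρ₂ ρ₁) x := (hasFDerivAt_cylCutoff ρ₂ ρ₁ x).differentiableAt
  have hφd : DifferentiableAt ℝ (radialCutoff ρ₂ ρ₁ : EuclideanSpace ℝ (Fin 3) → ℝ) (horizPart x) :=
    (hasFDerivAt_radialCutoff ρ₂ ρ₁ _).differentiableAt
  have h1 : fderiv ℝ (fun y => cylCutoff ρ₂ ρ₁ y ^ 2) x (eR x) =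
      2 * cylCutoff ρ₂ ρ₁ x * fderiv ℝ (cylCutoff ρ₂ ρ₁) x (eR x) := by
    rw [(hζd.hasFDerivAt.pow 2).fderiv]
    simp
  have h2 : fderiv ℝ (fun y => (radialCutoff ρ₂ ρ₁ : EuclideanSpace ℝ (Fin 3) → ℝ) y ^ 2) (horizPart x)
      (eR (horizPart x)) = 2 * radialCutoff ρ₂ ρ₁ (horizPart x) *
        fderiv ℝ (radialCutoff ρ₂ ρ₁ : EuclideanSpace ℝ (Fin 3) → ℝ) (horizPart x) (eR (horizPart x)) := by
    rw [(hφd.hasFDerivAt.pow 2).fderiv]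
    simp
  have hζ : cylCutoff ρ₂ ρ₁ x = radialCutoff ρ₂ ρ₁ (horizPart x) := rfl
  rw [h1, fderiv_cylCutoff, hζ, ← eR_horizPart x, ← cylRadius_horizPart x, ← h2]
  exact hrad

/-- The axis weight is measurable, bounded by the cut-off, and vanishes off `{r < ρ₁}`. [folklore] -/
private theorem axis_weight_props_pla {ρ₂ ρ₁ : ℝ} (h₀ : 0 ≤ ρ₂) (h₁ : ρ₂ < ρ₁) {CT : ℝ}
    (hCT : ∀ t, |deriv Real.smoothTransition t| ≤ CT) :
    Measurable (fun x : EuclideanSpace ℝ (Fin 3) =>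
      2 / cylRadius x * fderiv ℝ (fun y => cylCutoff ρ₂ ρ₁ y ^ 2) x (eR x)) ∧
    (∀ x, |2 / cylRadius x * fderiv ℝ (fun y => cylCutoff ρ₂ ρ₁ y ^ 2) x (eR x)| ≤
      8 * CT / (ρ₁ ^ 2 - ρ₂ ^ 2)) ∧
    (∀ x, ρ₁ ≤ cylRadius x → 2 / cylRadius x * fderiv ℝ (fun y => cylCutoff ρ₂ ρ₁ y ^ 2) x (eR x) = 0) := by
  have hb := abs_axis_weight_cylCutoff_sq_le h₀ h₁ hCT
  have hd : 0 < ρ₁ ^ 2 - ρ₂ ^ 2 := by nlinarith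
  have hCT0 : 0 ≤ CT := (abs_nonneg _).trans (hCT 0)
  refine ⟨?_, fun x => (hb x).trans ?_, fun x hx => ?_⟩
  · have hg : Continuous (gradient fun y : EuclideanSpace ℝ (Fin 3) => cylCutoff ρ₂ ρ₁ y ^ 2) :=
      continuous_gradient_of_contDiff ((contDiff_cylCutoff ρ₂ ρ₁ (n := 1)).pow 2)
    have e : (fun x : EuclideanSpace ℝ (Fin 3) => 2 / cylRadius x * fderiv ℝ (fun y => cylCutoff ρ₂ ρ₁ y ^ 2) x (eR x)) =
        fun x => 2 / cylRadius x * ⟪gradient (fun y => cylCutoff ρ₂ ρ₁ y ^ 2) x, eR x⟫ := by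
      funext x; rw [inner_gradient_left]
    rw [e]
    exact (measurable_const.div continuous_cylRadius.measurable).mul (hg.measurable.inner measurable_eR)
  · have h1 : cylCutoff ρ₂ ρ₁ x ≤ 1 := cylCutoff_le_one _ _ _
    calc 8 * CT / (ρ₁ ^ 2 - ρ₂ ^ 2) * cylCutoff ρ₂ ρ₁ x ≤ 8 * CT / (ρ₁ ^ 2 - ρ₂ ^ 2) * 1 :=
          mul_le_mul_of_nonneg_left h1 (by positivity)
      _ = _ := mul_one _
  · have h := hb x
    rw [cylCutoff_eq_zero h₀ h₁ hx, mul_zero] at h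
    exact abs_eq_zero.1 (le_antisymm h (abs_nonneg _))

/-- **The slab integral of the axis weight** (the boundary term "`2∬ζ_R²dθdz|_{r=0}`" per
period): `∫_{zSlab P 0} (2/r)∂ᵣ(ζ²) = −2c₂P` for `ζ = cylCutoff (ρ/2) ρ`, `P, ρ > 0`
(`c₂ = radialConst₂ = 2π`; the whole-space axis identity `integral_axis_term_eq_sub_boundary`
for `F ≡ 1` tested against the window cut-off `ζω(x₂)`, then the window reductions). [cite: LeiRenZhang2019, §3 (3.7) (the boundary term 2∬(Ψ−Ψ̄)ζ_R²dθdz|_{r=0} = C − CΨ̄), arXiv p. 7] -/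
theorem setIntegral_axis_weight_cylCutoff_sq {P ρ : ℝ} (hP : 0 < P) (hρ : 0 < ρ) :
    ∫ x in zSlab P 0, 2 / cylRadius x * fderiv ℝ (fun y => cylCutoff (ρ / 2) ρ y ^ 2) x (eR x) =
      -(2 * radialConst₂ * P) := by
  set ψ : EuclideanSpace ℝ (Fin 3) → ℝ := cylCutoff (ρ / 2) ρ with hψdef
  have hρ2 : 0 ≤ ρ / 2 := by positivity
  have hρ2' : 0 < ρ / 2 := by positivity
  have hρρ : ρ / 2 < ρ := half_lt_self hρ
  have hψ : ContDiff ℝ 2 ψ := contDiff_cylCutoff _ _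
  have hψa : IsAxisymmetricScalar ψ := isAxisymmetricScalar_cylCutoff _ _
  have hψz : ∀ (x : EuclideanSpace ℝ (Fin 3)) (t : ℝ), ψ (x + t • eZ) = ψ x := cylCutoff_add_smul_eZ _ _
  have hψ1 : ∀ x, cylRadius x ≤ ρ / 2 → ψ x = 1 := fun x hx => cylCutoff_eq_one hρ2 hρρ hx
  have hψ0 : ∀ x, ρ ≤ cylRadius x → ψ x = 0 := fun x hx => cylCutoff_eq_zero hρ2 hρρ hx
  obtain ⟨a, ha, haz, -, hψg⟩ := exists_gradient_cylCutoff_eq_smul_horizPart (ρ / 2) ρ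
  -- window reduction of the volume term
  have hA := axis_window_eq (F := fun _ => (0 : ℝ)) (H := fun _ => (1 : ℝ)) hP contDiff_const (fun _ => rfl)
    contDiff_const hψ hψz hρ2' hψ1 hψ0 (ha 0).continuous haz hψg
  simp only [one_mul] at hA
  -- the whole-space axis identity for `F ≡ 1`, tested with `φ̃ = ψ ω(x₂)`
  obtain ⟨φt, hφt⟩ : ∃ φt : EuclideanSpace ℝ (Fin 3) → ℝ, φt = fun y => ψ y * periodicWindow P (y 2) :=
    ⟨_, rfl⟩
  have hφt1 : ContDiff ℝ 1 φt := by
    rw [hφt]; exact contDiff_mul_comp_apply_two (hψ.of_le one_le_two) (contDiff_periodicWindow P)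
  have hφtc : HasCompactSupport φt := by
    rw [hφt]
    refine hasCompactSupport_mul_comp_apply_two hψ0 (A := 2 * P) fun z hz => ?_
    have h := mem_Ioo_of_periodicWindow_ne_zero hP hz
    rw [abs_le]; exact ⟨by linarith [h.1], h.2.le⟩
  have hφta : IsAxisymmetricScalar φt := by rw [hφt]; exact isAxisymmetricScalar_mul_comp_apply_two hψa _
  obtain ⟨-, -, hB⟩ := integral_axis_term_eq_sub_boundary (F := fun _ : EuclideanSpace ℝ (Fin 3) => (1 : ℝ))
    contDiff_const (fun _ _ => rfl) (H := fun v : ℝ => v) contDiff_id hφt1 hφtc hφta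
  have hL : ∫ x : EuclideanSpace ℝ (Fin 3), 2 / cylRadius x *
      (fderiv ℝ (fun _ : EuclideanSpace ℝ (Fin 3) => (1 : ℝ)) x (eR x) * (deriv (fun v : ℝ => v) 1 * φt x ^ 2)) = 0 := by
    simp
  rw [hL] at hB
  simp only [one_mul] at hB
  -- the boundary term per period
  have hbdry := axisBoundary_window_eq (F := fun _ => (0 : ℝ)) (H := fun _ => (1 : ℝ)) (ψ := ψ) hP
    continuous_const (fun _ => rfl) continuous_const hψz
  simp only [one_mul, intervalIntegral.integral_const, sub_zero, smul_eq_mul, mul_one] at hbdry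
  have hψ00 : ψ 0 = 1 := hψ1 0 (by simp [cylRadius]; positivity)
  rw [hψ00, one_pow, one_mul] at hbdry
  -- assemble
  have hvol : ∫ x, 2 / cylRadius x * fderiv ℝ (fun y => φt y ^ 2) x (eR x) =
      -(2 * radialConst₂ * ∫ z : ℝ, φt (meridianPoint (0, z)) ^ 2) := by linarith
  have e1 : (fun y => φt y ^ 2) = fun y => (ψ y * periodicWindow P (y 2)) ^ 2 := by rw [hφt]
  have e2 : (fun z : ℝ => φt (meridianPoint (0, z)) ^ 2) =
      fun z => (ψ (meridianPoint (0, z)) * periodicWindow P ((meridianPoint (0, z)) 2)) ^ 2 := by rw [hφt]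
  rw [e1, hA, e2, hbdry] at hvol
  exact hvol

/-- **The axis term for the logarithm, per period** (Lei–Ren–Zhang 2019, (3.7)). For
`0 < P ≤ ρ`, `ζ = cylCutoff (ρ/2) ρ`, `Z = ∫_{slab} ζ²`, an axially `P`-periodic `Ψ ∈ C¹` and
`δ > 0`:
`∫_{slab} (2/r) Ψ ∂ᵣ(ζ²) ≤ δ ∫_{slab} ‖∇Ψ‖²ζ² + (1048576 C_T²/(9δ)) P − (2c₂P/Z) ∫_{slab} Ψζ²`
(split `Ψ = (Ψ − Ψ̄) + Ψ̄`, `∫_{slab}(2/r)∂ᵣζ² = −2c₂P`, `|(2/r)∂ᵣζ²| ≤ (32C_T/(3ρ²))ζ`, Young,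
`|slab ∩ {r ≤ ρ}| ≤ 4ρ²P`, and the weighted Poincaré inequality per period (3.6)). [cite: LeiRenZhang2019, §3, proof of Lemma 3.1, (3.7) (arXiv p. 7), the axis term] -/
theorem integral_axis_term_log_le_periodic {P ρ : ℝ} (hP : 0 < P) (hPρ : P ≤ ρ)
    {Ψ : EuclideanSpace ℝ (Fin 3) → ℝ} (hΨ : ContDiff ℝ 1 Ψ) (hΨp : IsAxiallyPeriodic P Ψ) {CT : ℝ}
    (hCT : ∀ t, |deriv Real.smoothTransition t| ≤ CT) {δ : ℝ} (hδ : 0 < δ) :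
    ∫ x in zSlab P 0, 2 / cylRadius x * (Ψ x * fderiv ℝ (fun y => cylCutoff (ρ / 2) ρ y ^ 2) x (eR x)) ≤
      δ * (∫ x in zSlab P 0, ‖gradient Ψ x‖ ^ 2 * cylCutoff (ρ / 2) ρ x ^ 2) +
        1048576 * CT ^ 2 / (9 * δ) * P -
        (2 * radialConst₂ * P) / (∫ y in zSlab P 0, cylCutoff (ρ / 2) ρ y ^ 2) *
          ∫ x in zSlab P 0, Ψ x * cylCutoff (ρ / 2) ρ x ^ 2 := by
  have hρ : 0 < ρ := hP.trans_le hPρ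
  obtain ⟨hZpos, hPW⟩ := setIntegral_sub_average_sq_mul_cylCutoff_sq_le hP hPρ hΨ hΨp
  obtain ⟨-, -, hSvol⟩ := cylCutoff_sq_slab_mass hP hρ
  have hw := setIntegral_axis_weight_cylCutoff_sq hP hρ
  have hρ2 : 0 ≤ ρ / 2 := by positivity
  have hρρ : ρ / 2 < ρ := half_lt_self hρ
  obtain ⟨hwm, hwb, hw0⟩ := axis_weight_props_pla hρ2 hρρ hCT
  have hwζ := abs_axis_weight_cylCutoff_sq_le hρ2 hρρ hCT
  set φ : EuclideanSpace ℝ (Fin 3) → ℝ := cylCutoff (ρ / 2) ρ with hφdef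
  set w : EuclideanSpace ℝ (Fin 3) → ℝ := fun x => 2 / cylRadius x * fderiv ℝ (fun y => φ y ^ 2) x (eR x) with hwdef
  set Z : ℝ := ∫ y in zSlab P 0, φ y ^ 2 with hZ
  set m : ℝ := (∫ y in zSlab P 0, Ψ y * φ y ^ 2) / Z with hm
  set G : ℝ := ∫ x in zSlab P 0, ‖gradient Ψ x‖ ^ 2 * φ x ^ 2 with hG
  set κ : ℝ := 8 * CT / (ρ ^ 2 - (ρ / 2) ^ 2) with hκ
  set S : Set (EuclideanSpace ℝ (Fin 3)) := zSlab P 0 ∩ {x | cylRadius x ≤ ρ} with hS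
  have hCT0 : 0 ≤ CT := (abs_nonneg _).trans (hCT 0)
  have hκ0 : 0 ≤ κ := by rw [hκ]; exact div_nonneg (by positivity) (by nlinarith)
  have hκe : κ = 32 * CT / (3 * ρ ^ 2) := by rw [hκ]; field_simp; ring
  have hφc : Continuous φ := (contDiff_cylCutoff (ρ / 2) ρ (n := 0)).continuous
  have hφ0 : ∀ x, 0 ≤ φ x := fun x => cylCutoff_nonneg _ _ _
  have hφρ : ∀ x, ρ ≤ cylRadius x → φ x = 0 := fun x hx => cylCutoff_eq_zero hρ2 hρρ hx
  have hΨc : Continuous Ψ := hΨ.continuous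
  -- measure-theoretic facts on the slab and on `S`
  have hslab : MeasurableSet (zSlab P 0) := measurableSet_zSlab P 0
  have hcyl : MeasurableSet {x : EuclideanSpace ℝ (Fin 3) | cylRadius x ≤ ρ} :=
    measurableSet_le continuous_cylRadius.measurable measurable_const
  have hSm : MeasurableSet S := hslab.inter hcyl
  have hSK : S ⊆ {x : EuclideanSpace ℝ (Fin 3) | x 2 ∈ Icc 0 P ∧ cylRadius x ≤ ρ} := fun x hx => by
    have h := mem_zSlab.1 hx.1
    simp only [Int.cast_zero, zero_mul, zero_add, one_mul] at h
    exact ⟨⟨h.1, h.2.le⟩, hx.2⟩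
  have hS_top : volume S ≠ ∞ :=
    ((measure_mono hSK).trans_lt (isCompact_box_pla P ρ).measure_lt_top).ne
  -- a bound for `Ψ` on `S`
  obtain ⟨CΨ, hCΨ⟩ : ∃ C, ∀ x ∈ {x : EuclideanSpace ℝ (Fin 3) | x 2 ∈ Icc 0 P ∧ cylRadius x ≤ ρ}, ‖Ψ x‖ ≤ C :=
    (isCompact_box_pla P ρ).exists_bound_of_continuousOn hΨc.continuousOn
  have hw0' : ∀ x, ρ ≤ cylRadius x → w x = 0 := fun x hx => hw0 x hx
  have hwζ' : ∀ x, |w x| ≤ κ * φ x := fun x => hwζ x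
  have hwb' : ∀ x, |w x| ≤ κ := fun x => hwb x
  have hCΨ0 : 0 ≤ CΨ := (norm_nonneg _).trans (hCΨ 0 ⟨⟨le_rfl, hP.le⟩, by simp [cylRadius]; exact hρ.le⟩)
  -- integrability on the slab of `g · w` for continuous `g`
  have hint : ∀ {g : EuclideanSpace ℝ (Fin 3) → ℝ}, Continuous g → {C : ℝ} →
      (∀ x ∈ {x : EuclideanSpace ℝ (Fin 3) | x 2 ∈ Icc 0 P ∧ cylRadius x ≤ ρ}, ‖g x‖ ≤ C) →
      IntegrableOn (fun x => g x * w x) (zSlab P 0) volume := by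
    intro g hg C hgC
    have hC0 : 0 ≤ C := (norm_nonneg _).trans (hgC 0 ⟨⟨le_rfl, hP.le⟩, by simp [cylRadius]; exact hρ.le⟩)
    have h1 : IntegrableOn (fun x => g x * w x) S volume := by
      refine Measure.integrableOn_of_bounded hS_top ((hg.measurable.mul hwm).aestronglyMeasurable) (M := C * κ)
        ((ae_restrict_iff' hSm).2 (ae_of_all _ fun x hx => ?_))
      rw [norm_mul]
      exact mul_le_mul (hgC x (hSK hx)) ((Real.norm_eq_abs _).le.trans (hwb' x)) (norm_nonneg _) hC0
    exact h1.of_forall_sdiff_eq_zero hslab fun x hx => by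
      have hr : ¬cylRadius x ≤ ρ := fun h => hx.2 ⟨hx.1, h⟩
      rw [hw0' x (not_le.1 hr).le, mul_zero]
  have hiΨw : IntegrableOn (fun x => Ψ x * w x) (zSlab P 0) volume := hint hΨc hCΨ
  have hi1w : IntegrableOn (fun x => (1 : ℝ) * w x) (zSlab P 0) volume :=
    hint continuous_const (C := 1) fun x _ => by simp
  have hiw : IntegrableOn w (zSlab P 0) volume := by simpa using hi1w
  have hidw : IntegrableOn (fun x => (Ψ x - m) * w x) (zSlab P 0) volume := by
    have h : (fun x => (Ψ x - m) * w x) = fun x => Ψ x * w x - m * w x := by funext x; ring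
    rw [h]; exact hiΨw.sub (hiw.const_mul m)
  -- ### the split `Ψ = (Ψ − m) + m`
  have hsplit : ∫ x in zSlab P 0, 2 / cylRadius x * (Ψ x * fderiv ℝ (fun y => φ y ^ 2) x (eR x)) =
      (∫ x in zSlab P 0, (Ψ x - m) * w x) + m * ∫ x in zSlab P 0, w x := by
    rw [← MeasureTheory.integral_const_mul, ← integral_add hidw (hiw.const_mul m)]
    refine integral_congr_ae (ae_of_all _ fun x => ?_)
    simp only [hwdef]; ring
  rw [hsplit, hw]
  -- ### the fluctuation term by Young and Poincaré
  set δ' : ℝ := δ / (1024 * ρ ^ 2) with hδ'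
  have hδ'0 : 0 < δ' := by positivity
  have hpt : ∀ x, (Ψ x - m) * w x ≤
      δ' * ((Ψ x - m) ^ 2 * φ x ^ 2) + κ ^ 2 / (4 * δ') * ({x | cylRadius x ≤ ρ} : Set _).indicator (fun _ => (1 : ℝ)) x := by
    intro x
    by_cases hx : cylRadius x ≤ ρ
    · rw [indicator_of_mem (show x ∈ {x : EuclideanSpace ℝ (Fin 3) | cylRadius x ≤ ρ} from hx), mul_one]
      have hb : |(Ψ x - m) * w x| ≤ (|Ψ x - m| * φ x) * κ := by
        rw [abs_mul]
        calc |Ψ x - m| * |w x| ≤ |Ψ x - m| * (κ * φ x) := mul_le_mul_of_nonneg_left (hwζ' x) (abs_nonneg _)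
          _ = (|Ψ x - m| * φ x) * κ := by ring
      have hy : (|Ψ x - m| * φ x) * κ ≤ δ' * (|Ψ x - m| * φ x) ^ 2 + κ ^ 2 / (4 * δ') := by
        have h := sq_nonneg (2 * δ' * (|Ψ x - m| * φ x) - κ)
        have h4 : 0 < 4 * δ' := by positivity
        rw [div_eq_mul_inv]
        nlinarith [mul_inv_cancel₀ h4.ne', sq_nonneg κ]
      calc (Ψ x - m) * w x ≤ |(Ψ x - m) * w x| := le_abs_self _
        _ ≤ δ' * (|Ψ x - m| * φ x) ^ 2 + κ ^ 2 / (4 * δ') := hb.trans hy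
        _ = δ' * ((Ψ x - m) ^ 2 * φ x ^ 2) + κ ^ 2 / (4 * δ') := by rw [mul_pow, sq_abs]
    · rw [indicator_of_notMem (show x ∉ {x : EuclideanSpace ℝ (Fin 3) | cylRadius x ≤ ρ} from hx), mul_zero,
        add_zero, hw0' x (not_le.1 hx).le, mul_zero]
      positivity
  have hiA : IntegrableOn (fun x => (Ψ x - m) ^ 2 * φ x ^ 2) (zSlab P 0) volume :=
    integrableOn_zSlab_of_eq_zero_of_le_cylRadius (((hΨc.sub continuous_const).pow 2).mul (hφc.pow 2))
      (ρ := ρ) (fun x hx => by simp [hφρ x hx]) P 0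
  have hiI : IntegrableOn (({x | cylRadius x ≤ ρ} : Set (EuclideanSpace ℝ (Fin 3))).indicator fun _ => (1 : ℝ))
      (zSlab P 0) volume := by
    refine Measure.integrableOn_of_bounded (M := 1) ?_ ((measurable_const.indicator hcyl).aestronglyMeasurable)
      (ae_of_all _ fun x => ?_) |>.of_forall_sdiff_eq_zero hslab (s := S) fun x hx => ?_
    · exact hS_top
    · by_cases h : x ∈ ({x | cylRadius x ≤ ρ} : Set (EuclideanSpace ℝ (Fin 3)))
      · rw [indicator_of_mem h]; simp
      · rw [indicator_of_notMem h]; simp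
    · exact indicator_of_notMem (fun h => hx.2 ⟨hx.1, h⟩) _
  have hfluc : ∫ x in zSlab P 0, (Ψ x - m) * w x ≤
      δ' * (∫ x in zSlab P 0, (Ψ x - m) ^ 2 * φ x ^ 2) + κ ^ 2 / (4 * δ') * volume.real S := by
    calc ∫ x in zSlab P 0, (Ψ x - m) * w x
        ≤ ∫ x in zSlab P 0, (δ' * ((Ψ x - m) ^ 2 * φ x ^ 2) +
            κ ^ 2 / (4 * δ') * ({x | cylRadius x ≤ ρ} : Set _).indicator (fun _ => (1 : ℝ)) x) :=
          integral_mono_ae hidw ((hiA.const_mul δ').add (hiI.const_mul _)) (ae_of_all _ hpt)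
      _ = δ' * (∫ x in zSlab P 0, (Ψ x - m) ^ 2 * φ x ^ 2) + κ ^ 2 / (4 * δ') * volume.real S := by
          rw [integral_add (hiA.const_mul δ') (hiI.const_mul _), MeasureTheory.integral_const_mul,
            MeasureTheory.integral_const_mul, setIntegral_indicator hcyl, setIntegral_const, smul_eq_mul, mul_one]
  -- ### assemble
  have hG0 : 0 ≤ G := setIntegral_nonneg hslab fun x _ => by positivity
  have h1 : δ' * (∫ x in zSlab P 0, (Ψ x - m) ^ 2 * φ x ^ 2) ≤ δ * G := by
    calc δ' * (∫ x in zSlab P 0, (Ψ x - m) ^ 2 * φ x ^ 2) ≤ δ' * (1024 * ρ ^ 2 * G) :=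
          mul_le_mul_of_nonneg_left hPW hδ'0.le
      _ = δ * G := by rw [hδ']; field_simp
  have h2 : κ ^ 2 / (4 * δ') * volume.real S ≤ 1048576 * CT ^ 2 / (9 * δ) * P := by
    calc κ ^ 2 / (4 * δ') * volume.real S ≤ κ ^ 2 / (4 * δ') * (4 * ρ ^ 2 * P) :=
          mul_le_mul_of_nonneg_left hSvol (by positivity)
      _ = 1048576 * CT ^ 2 / (9 * δ) * P := by
          rw [hκe, hδ']; field_simp; ring
  have h3 : m * -(2 * radialConst₂ * P) = -((2 * radialConst₂ * P) / Z * ∫ x in zSlab P 0, Ψ x * φ x ^ 2) := by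
    rw [hm]; field_simp
  rw [h3]
  linarith [hfluc, h1, h2]

end LeiRenZhang2019

end Literature.Analysis.FluidPDE

end
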